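import Mathlib.Analysis.Calculus.InverseFunctionTheorem.FDeriv
import Mathlib.Analysis.Calculus.ContDiff.Operations
import Mathlib.Analysis.Calculus.ContDiff.RCLike
import Mathlib.Analysis.Calculus.FDeriv.Equiv
import Mathlib.Analysis.Calculus.FDeriv.Mul
import Mathlib.Analysis.Calculus.Deriv.Slope
import Mathlib.Analysis.Calculus.Deriv.Comp
import Mathlib.Analysis.Calculus.Deriv.Mul
import Mathlib.Analysis.InnerProductSpace.Calculus
import Mathlib.Analysis.SpecialFunctions.SmoothTransition
import Mathlib.Analysis.Normed.Operator.Bilinear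
import Mathlib.Geometry.Euclidean.Inversion.Basic
import Mathlib.Topology.Order.IntermediateValue
import Mathlib.Geometry.Manifold.Diffeomorph
import Mathlib.LinearAlgebra.FiniteDimensional.Basic
import Mathlib.Topology.Algebra.Module.FiniteDimension
import Literature.Topology.FourManifolds.CompactlySupportedDiffeo
import HarnessLib

/-!
# Extending an inverted germ of a local diffeomorphism to a diffeomorphism of `ℝⁿ`

Trunk `Literature/Topology/FourManifolds` (differential topology support for route
`SmoothPoincare4/SymplecticCap`, fact `Literature.Geometry.Symplectic.palais_puncturedSphere_chartForm` of
`Literature/Geometry/Symplectic/GromovMcDuffChartForm.lean`). Everything here is PROVED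
(no named facts); the file is the Euclidean-space half of the discharge of that fact.

## Main result

Let `F` be a finite-dimensional real inner product space, `ι z = z / ‖z‖²` the inversion in the
unit sphere (`Literature.Topology.FourManifolds.sphereInversion`; on `ℝ⁴` this is `Literature.Geometry.Symplectic.inversion` verbatim) and
`h : F → F` a map which is `C^∞` on a neighbourhood of `0`, with `h 0 = 0` and invertible
differential `Dh(0)`. Then (`Literature.Topology.FourManifolds.exists_diffeomorph_sphereInversion_conj`)

> there are a diffeomorphism `G : F ≃ₘ F` and `δ > 0` with `G (ι y) = ι (h y)` for all
> `0 < ‖y‖ < δ`,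

i.e. the germ *at infinity* `ι ∘ h ∘ ι` of the inverted local diffeomorphism extends to a global
diffeomorphism of `F`. This is the form of **Palais' local-triviality / disc theorem** (Palais
1960, Thm. B and §5; Hirsch, *Differential Topology*, Ch. 8, Thm. 3.1) that the punctured-sphere
chart statement consumes: after stereographic projection, straightening a diffeomorphism
`M ∖ {p} ≅ ℝⁿ` so that it becomes the inverted chart near the puncture is exactly extending the
inverted transition germ to a diffeomorphism of `ℝⁿ`.

## Proof (elementary)

1. `Literature.Topology.FourManifolds.diffeomorphOfContDiffBijective` — **global inverse function theorem**: a smooth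
   bijection of `F` with everywhere-injective differential is a diffeomorphism (Mathlib's
   `isOpenMap_of_hasStrictFDerivAt_equiv` + `Homeomorph.contDiff_symm`).
2. `Literature.Topology.FourManifolds.GermExtension.exists_diffeomorph_eq_near_zero_eq_id_far` — **germ extension,
   tangent-to-the-identity case**: if `Dh₁(0) = id`, some diffeomorphism `H` of `F` equals `h₁`
   on `closedBall 0 δ` and `id` outside the unit ball. This is a repackaging of the tree's
   bump-function splice `Literature.Topology.FourManifolds.exists_diffeomorph_eq_of_fderiv_eq_id`
   (`Literature/Topology/FourManifolds/CompactlySupportedDiffeo.lean`, Hirsch Ch. 8 §3).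
3. `Literature.Topology.FourManifolds.sphereInversion` is Mathlib's `EuclideanGeometry.inversion 0 1` (proved:
   `Literature.Topology.FourManifolds.sphereInversion.eq_inversion`), kept in the definitional shape `(‖z‖²)⁻¹ • z` of
   `Literature.Geometry.Symplectic.inversion`; its involutivity/norm/`C^n` API is transported from Mathlib.
   `Literature.Topology.FourManifolds.sphereConjDiffeomorph` — **`ι`-conjugation**: for such `H`, `ι H ι` is a diffeomorphism
   of `F` (the identity on the unit ball) with `(ι H ι) (ι y) = ι (H y)`.
4. `Literature.InvertedLinear.*` — **straightening the linear part**: for `A ∈ GL(F)` the map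
   `ι A ι (z) = (‖z‖² / ‖A z‖²) • A z` is homogeneous of degree one but not smooth at `0` unless
   `A` is conformal; the radial interpolation `G₂ z = μ(z) • A z`, `μ = ρ + χ (c - ρ)` with
   `ρ = ‖z‖²/‖Az‖² ≥ c = (‖A‖² + 1)⁻¹` and `χ = smoothTransition (2 - ‖z‖²)`, is smooth, equals
   `c • A` on the unit ball and `ι A ι` for `‖z‖² ≥ 2`, is bijective (ray by ray, `t ↦ t μ(tz)` is
   strictly increasing and `≥ c t`) and has injective differential (`Dμ(z) z ≥ 0` by monotonicity
   along rays), hence is a diffeomorphism by step 1.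
5. Assembly: with `A = Dh(0)`, `h₁ = A⁻¹ ∘ h`, `G = G₂ ∘ (ι H ι)`:
   `G (ι y) = G₂ (ι (h₁ y)) = ι (A (h₁ y)) = ι (h y)` for `y ≠ 0` small.

## References

* R. S. Palais, *Extending diffeomorphisms*, Proc. Amer. Math. Soc. 11 (1960), 274–277, Thm. B,
  §5 [Palais1960].
* M. W. Hirsch, *Differential Topology*, GTM 33, Springer (1976), Ch. 8, Thm. 3.1.
* J. Milnor, *Topology from the differentiable viewpoint* (1965), §6, Lemma (homogeneity /
  isotopy extension by compactly supported perturbations of the identity).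
-/

open scoped Manifold ContDiff Topology NNReal
open Function Set Metric

noncomputable section

namespace Literature.Topology.FourManifolds


section NormedSpace

variable {F : Type*} [NormedAddCommGroup F] [NormedSpace ℝ F] [FiniteDimensional ℝ F]

/-! ### A global inverse function theorem -/


/-- The derivative of `f` at `a` as a continuous linear equivalence, when it is injective
(finite dimension). [folklore] -/
noncomputable def fderivEquivOfInjective (f : F → F) (a : F)
    (h : Injective (fderiv ℝ f a)) : F ≃L[ℝ] F :=
  (LinearEquiv.ofInjectiveEndo (fderiv ℝ f a : F →ₗ[ℝ] F) h).toContinuousLinearEquiv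

/-- `fderivEquivOfInjective f a h` is `fderiv ℝ f a` as a continuous linear map. [folklore] -/
@[simp] theorem coe_fderivEquivOfInjective (f : F → F) (a : F) (h : Injective (fderiv ℝ f a)) :
    ((fderivEquivOfInjective f a h : F ≃L[ℝ] F) : F →L[ℝ] F) = fderiv ℝ f a := by
  ext v; rfl

/-- **Global inverse function theorem (criterion for a diffeomorphism of `ℝⁿ`).** A smooth
bijection of a finite-dimensional real normed space whose differential is injective at every
point is a diffeomorphism (Mathlib `isOpenMap_of_hasStrictFDerivAt_equiv` +
`Homeomorph.contDiff_symm`; injectivity of `Df(a)` suffices by finite-dimensionality,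
`fderivEquivOfInjective`). This is the vector-space case, kept import-light for this calculus
file, of the tree's manifold version `Literature.Topology.FourManifolds.diffeomorphOfBijectiveOfMfderiv`
(`Literature/Topology/FourManifolds/InverseFunctionTheorem.lean`). [folklore] -/
noncomputable def diffeomorphOfContDiffBijective (f : F → F) (hf : ContDiff ℝ ∞ f)
    (hb : Bijective f) (hd : ∀ a, Injective (fderiv ℝ f a)) : F ≃ₘ⟮𝓘(ℝ, F), 𝓘(ℝ, F)⟯ F :=
  haveI : CompleteSpace F := FiniteDimensional.complete ℝ F
  have hderiv : ∀ a, HasFDerivAt f (fderivEquivOfInjective f a (hd a) : F →L[ℝ] F) a := fun a => by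
    rw [coe_fderivEquivOfInjective]
    exact (hf.differentiable (by simp) a).hasFDerivAt
  have hstrict : ∀ a, HasStrictFDerivAt f (fderivEquivOfInjective f a (hd a) : F →L[ℝ] F) a :=
    fun a => by
    rw [coe_fderivEquivOfInjective]
    exact hf.contDiffAt.hasStrictFDerivAt (by simp)
  let e : F ≃ₜ F := (Equiv.ofBijective f hb).toHomeomorphOfContinuousOpen hf.continuous
    (isOpenMap_of_hasStrictFDerivAt_equiv hstrict)
  have he : (e : F → F) = f := rfl
  { toEquiv := e.toEquiv
    contMDiff_toFun := contMDiff_iff_contDiff.2 hf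
    contMDiff_invFun := by
      have : ContDiff ℝ ∞ (e.symm : F → F) := e.contDiff_symm hderiv hf
      exact contMDiff_iff_contDiff.2 this }

/-- `diffeomorphOfContDiffBijective f _ _ _` is `f` as a function. [folklore] -/
@[simp] theorem coe_diffeomorphOfContDiffBijective (f : F → F) (hf : ContDiff ℝ ∞ f)
    (hb : Bijective f) (hd : ∀ a, Injective (fderiv ℝ f a)) :
    ⇑(diffeomorphOfContDiffBijective f hf hb hd) = f := rfl


/-! ### Germ extension, tangent-to-the-identity case -/

namespace GermExtension

/-- **Germ extension (Palais-type lemma, tangent-to-the-identity case).** If `h` is smooth near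
`0`, `h 0 = 0` and `Dh(0) = id`, then some diffeomorphism `H` of `F` agrees with `h` on a
neighbourhood `closedBall 0 δ` of `0` and with the identity outside the unit ball. This is the
packaging used below of the tree's `Literature.Topology.FourManifolds.exists_diffeomorph_eq_of_fderiv_eq_id`
(`CompactlySupportedDiffeo.lean`: `G = h` on `B̄(0, r)`, `G = id` off `B(0, 2r)`, with
`B̄(0, 2r) ⊆ V`), applied to the open set `V = interior s ∩ B(0, 1)`, which forces `2r < 1`
wherever it matters. [folklore] -/
theorem exists_diffeomorph_eq_near_zero_eq_id_far {h : F → F} {s : Set F} (hs : s ∈ 𝓝 (0 : F))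
    (hh : ContDiffOn ℝ ∞ h s) (h0 : h 0 = 0) (hd : fderiv ℝ h 0 = ContinuousLinearMap.id ℝ F) :
    ∃ (H : F ≃ₘ⟮𝓘(ℝ, F), 𝓘(ℝ, F)⟯ F) (δ : ℝ), 0 < δ ∧ (∀ x, ‖x‖ ≤ δ → H x = h x) ∧
      ∀ x, 1 ≤ ‖x‖ → H x = x := by
  set V : Set F := interior s ∩ ball 0 1 with hV
  have hVo : IsOpen V := isOpen_interior.inter isOpen_ball
  have h0V : (0 : F) ∈ V := ⟨mem_interior_iff_mem_nhds.2 hs, mem_ball_self one_pos⟩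
  have hhV : ContDiffOn ℝ ∞ h V := hh.mono (inter_subset_left.trans interior_subset)
  obtain ⟨r, hr, hsub, G, hG₁, hG₂⟩ := exists_diffeomorph_eq_of_fderiv_eq_id hVo h0V hhV h0 hd
  refine ⟨G, r, hr, fun x hx => hG₁ x (mem_closedBall_zero_iff.2 hx), fun x hx => hG₂ x ?_⟩
  by_contra hlt
  have hxV : x ∈ V := hsub (mem_closedBall_zero_iff.2 (not_le.1 hlt).le)
  have hx1 : ‖x‖ < 1 := mem_ball_zero_iff.1 hxV.2
  linarith

end GermExtension


end NormedSpace

section InnerProductSpace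

variable {F : Type*} [NormedAddCommGroup F] [InnerProductSpace ℝ F]
variable {F' : Type*} [NormedAddCommGroup F'] [InnerProductSpace ℝ F']

/-! ### The inversion in the unit sphere -/

/-- The **inversion in the unit sphere** centred at the origin, `ι z = z / ‖z‖²`
(junk value `ι 0 = 0`). [folklore] -/
def sphereInversion (z : F) : F := (‖z‖ ^ 2)⁻¹ • z

namespace sphereInversion

local notation "ι" => sphereInversion

/-- Unfolding: `ι z = (‖z‖²)⁻¹ • z`. [folklore] -/
theorem apply_def (z : F) : ι z = (‖z‖ ^ 2)⁻¹ • z := rfl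

/-- `ι` is Mathlib's inversion `EuclideanGeometry.inversion` in the unit sphere centred at `0`
(the definitional shape `(‖z‖²)⁻¹ • z` is kept so that `Literature.SPC4.inversion = ι` on `ℝ⁴` is
`rfl`). [folklore] -/
theorem eq_inversion : (sphereInversion : F → F) = EuclideanGeometry.inversion (0 : F) 1 := by
  funext z
  simp [apply_def, EuclideanGeometry.inversion, div_eq_inv_mul, inv_pow]

/-- Pointwise form of `eq_inversion`. [folklore] -/
theorem apply_eq_inversion (z : F) : ι z = EuclideanGeometry.inversion (0 : F) 1 z :=
  congrFun eq_inversion z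

/-- The junk value: `ι 0 = 0` (Mathlib `EuclideanGeometry.inversion_self`). [folklore] -/
@[simp] theorem apply_zero : ι (0 : F) = 0 := by
  rw [apply_eq_inversion, EuclideanGeometry.inversion_self]

/-- `‖ι z‖ = ‖z‖⁻¹` (both sides vanish at `z = 0`; Mathlib
`EuclideanGeometry.dist_inversion_center`). [folklore] -/
theorem norm_apply (z : F) : ‖ι z‖ = ‖z‖⁻¹ := by
  have h := EuclideanGeometry.dist_inversion_center (0 : F) z 1
  rwa [dist_zero_right, dist_zero_right, one_pow, one_div, ← apply_eq_inversion] at h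

/-- `ι z = 0` exactly at the junk point `z = 0` (Mathlib `EuclideanGeometry.inversion_eq_center`).
[folklore] -/
@[simp] theorem eq_zero_iff {z : F} : ι z = 0 ↔ z = 0 := by
  rw [apply_eq_inversion, EuclideanGeometry.inversion_eq_center one_ne_zero]

/-- `ι z ≠ 0` for `z ≠ 0`. [folklore] -/
theorem ne_zero {z : F} (hz : z ≠ 0) : ι z ≠ 0 := fun h => hz (eq_zero_iff.1 h)

/-- `ι` is an involution, also at the junk point (Mathlib `EuclideanGeometry.inversion_inversion`).
[folklore] -/
@[simp] theorem apply_apply (z : F) : ι (ι z) = z := by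
  rw [apply_eq_inversion, apply_eq_inversion, EuclideanGeometry.inversion_inversion _ one_ne_zero]

/-- `ι` is an involution of `F` (Mathlib `EuclideanGeometry.inversion_involutive`). [folklore] -/
theorem involutive : Function.Involutive (sphereInversion (F := F)) := by
  rw [eq_inversion]
  exact EuclideanGeometry.inversion_involutive _ one_ne_zero

/-- `ι` is a bijection of `F` (Mathlib `EuclideanGeometry.inversion_bijective`). [folklore] -/
theorem bijective : Function.Bijective (sphereInversion (F := F)) := involutive.bijective

/-- `ι` is injective. [folklore] -/
theorem injective : Function.Injective (sphereInversion (F := F)) := involutive.injective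

/-- `ι` is homogeneous of degree `-1`: `ι (c • z) = c⁻¹ • ι z` (all `c`, junk conventions matching).
[folklore] -/
theorem apply_smul (c : ℝ) (z : F) : ι (c • z) = c⁻¹ • ι z := by
  rcases eq_or_ne c 0 with rfl | hc
  · simp
  rcases eq_or_ne z 0 with rfl | hz
  · simp
  rw [apply_def, apply_def, norm_smul, smul_smul, smul_smul, Real.norm_eq_abs]
  congr 1
  have : ‖z‖ ≠ 0 := norm_ne_zero_iff.2 hz
  have habs : |c| ≠ 0 := abs_ne_zero.2 hc
  field_simp
  rw [sq_abs]

/-- `ι` commutes with linear isometries. [folklore] -/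
theorem apply_linearIsometry (L : F →ₗᵢ[ℝ] F') (z : F) : ι (L z) = L (ι z) := by
  simp [apply_def, L.norm_map]

/-- `ι` commutes with linear isometric equivalences. [folklore] -/
theorem apply_linearIsometryEquiv (L : F ≃ₗᵢ[ℝ] F') (z : F) : ι (L z) = L (ι z) := by
  simp [apply_def, L.norm_map]

/-- `ι` is `C^n` at every `z ≠ 0`, for every `n : ℕ∞ω` including `ω` (Mathlib's
`ContDiffAt.inversion` is stated for `n : ℕ∞` only, so the direct three-line proof is kept).
[folklore] -/
theorem contDiffAt {n : ℕ∞ω} {z : F} (hz : z ≠ 0) :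
    ContDiffAt ℝ n (sphereInversion (F := F)) z := by
  have h1 : ContDiffAt ℝ n (fun y : F => ‖y‖ ^ 2) z := (contDiff_norm_sq ℝ).contDiffAt
  have h2 : ‖z‖ ^ 2 ≠ 0 := pow_ne_zero 2 (norm_ne_zero_iff.2 hz)
  exact (h1.inv h2).smul contDiffAt_id

/-- `ι` is `C^n` on `{0}ᶜ`. [folklore] -/
theorem contDiffOn {n : ℕ∞ω} : ContDiffOn ℝ n (sphereInversion (F := F)) {0}ᶜ :=
  fun _ hz => (contDiffAt hz).contDiffWithinAt

/-- `ι` is continuous at every `z ≠ 0`. [folklore] -/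
theorem continuousAt {z : F} (hz : z ≠ 0) : ContinuousAt (sphereInversion (F := F)) z :=
  (contDiffAt (n := 0) hz).continuousAt

/-- `ι` is continuous on `{0}ᶜ`. [folklore] -/
theorem continuousOn : ContinuousOn (sphereInversion (F := F)) {0}ᶜ :=
  fun _ hz => (continuousAt hz).continuousWithinAt

/-- `ι` fixes the unit sphere and swaps its inside and outside: `1 ≤ ‖z‖ ↔ ‖ι z‖ ≤ 1` for
`z ≠ 0`. [folklore] -/
theorem norm_apply_le_one_iff {z : F} (hz : z ≠ 0) : ‖ι z‖ ≤ 1 ↔ 1 ≤ ‖z‖ := by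
  rw [norm_apply]
  exact inv_le_one_iff₀.trans ⟨fun h => h.resolve_left (not_le.2 (norm_pos_iff.2 hz)), Or.inr⟩

/-- `1 ≤ ‖ι z‖ ↔ ‖z‖ ≤ 1` for `z ≠ 0`. [folklore] -/
theorem one_le_norm_apply_iff {z : F} (hz : z ≠ 0) : 1 ≤ ‖ι z‖ ↔ ‖z‖ ≤ 1 := by
  rw [norm_apply, one_le_inv_iff₀]
  exact ⟨fun h => h.2, fun h => ⟨norm_pos_iff.2 hz, h⟩⟩

end sphereInversion

/-! ### Conjugating a diffeomorphism fixing `0` and a neighbourhood of infinity by `ι` -/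

section SphereConj

local notation "ι" => sphereInversion

variable (H : F ≃ₘ⟮𝓘(ℝ, F), 𝓘(ℝ, F)⟯ F)

/-- The `ι`-conjugate `z ↦ ι (H (ι z))` of a self-map of `F`, as a bare function. [folklore] -/
def sphereConjFun (H : F → F) (z : F) : F := ι (H (ι z))

/-- Unfolding of `sphereConjFun`. [folklore] -/
theorem sphereConjFun_apply (H : F → F) (z : F) : sphereConjFun H z = ι (H (ι z)) := rfl

/-- `ι`-conjugation is multiplicative: `(ι H ι) ∘ (ι H' ι) = ι (H ∘ H') ι`. [folklore] -/
theorem sphereConjFun_comp (H H' : F → F) :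
    sphereConjFun H ∘ sphereConjFun H' = sphereConjFun (H ∘ H') := by
  funext z; simp [sphereConjFun]

/-- `(ι H ι) (ι y) = ι (H y)`. [folklore] -/
theorem sphereConjFun_sphereInversion (H : F → F) (y : F) :
    sphereConjFun H (ι y) = ι (H y) := by simp [sphereConjFun]

/-- If `H` fixes `0` and is the identity outside the open unit ball, then `ι H ι` is the identity
on the closed unit ball. [folklore] -/
theorem sphereConjFun_of_norm_le_one {H : F → F} (h0 : H 0 = 0) (hfar : ∀ x, 1 ≤ ‖x‖ → H x = x)
    {z : F} (hz : ‖z‖ ≤ 1) : sphereConjFun H z = z := by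
  rcases eq_or_ne z 0 with rfl | hz0
  · simp [sphereConjFun, h0]
  · rw [sphereConjFun, hfar _ ((sphereInversion.one_le_norm_apply_iff hz0).2 hz),
      sphereInversion.apply_apply]

/-- Smoothness of `ι H ι` for `H` smooth, injective, fixing `0` and equal to the identity outside
the unit ball. [folklore] -/
theorem contDiff_sphereConjFun {H : F → F} (hH : ContDiff ℝ ∞ H) (hinj : Injective H)
    (h0 : H 0 = 0) (hfar : ∀ x, 1 ≤ ‖x‖ → H x = x) : ContDiff ℝ ∞ (sphereConjFun H) := by
  rw [contDiff_iff_contDiffAt]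
  intro z
  by_cases hz : ‖z‖ < 1
  · -- locally the identity
    have : sphereConjFun H =ᶠ[𝓝 z] id := by
      filter_upwards [isOpen_ball.mem_nhds (mem_ball_zero_iff.2 hz)] with y hy
      exact sphereConjFun_of_norm_le_one h0 hfar (le_of_lt (mem_ball_zero_iff.1 hy))
    exact contDiffAt_id.congr_of_eventuallyEq this
  · have hz0 : z ≠ 0 := by
      rintro rfl; exact hz (by simp)
    have h1 : H (ι z) ≠ 0 := by
      intro h
      apply sphereInversion.ne_zero hz0
      exact hinj (h.trans h0.symm)
    exact (sphereInversion.contDiffAt h1).comp z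
      (hH.contDiffAt.comp z (sphereInversion.contDiffAt hz0))

/-- If `H` is the identity outside the unit ball then so is `H⁻¹`. [folklore] -/
theorem symm_apply_eq_self_of {x : F} (hfar : ∀ x, 1 ≤ ‖x‖ → H x = x) (hx : 1 ≤ ‖x‖) :
    H.symm x = x := by
  conv_lhs => rw [← hfar x hx]
  exact H.symm_apply_apply x

/-- If `H 0 = 0` then `H⁻¹ 0 = 0`. [folklore] -/
theorem symm_apply_zero_of (h0 : H 0 = 0) : H.symm 0 = 0 := by
  conv_lhs => rw [← h0]
  exact H.symm_apply_apply 0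

/-- **`ι`-conjugation.** For a diffeomorphism `H` of `F` fixing `0` and equal to the identity
outside the unit ball, `z ↦ ι (H (ι z))` is again a diffeomorphism of `F` (the identity on the
unit ball, and "`H` transported to a neighbourhood of infinity"). [folklore] -/
def sphereConjDiffeomorph (h0 : H 0 = 0) (hfar : ∀ x, 1 ≤ ‖x‖ → H x = x) :
    F ≃ₘ⟮𝓘(ℝ, F), 𝓘(ℝ, F)⟯ F where
  toFun := sphereConjFun H
  invFun := sphereConjFun H.symm
  left_inv z := by simp [sphereConjFun]
  right_inv z := by simp [sphereConjFun]
  contMDiff_toFun := contMDiff_iff_contDiff.2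
    (contDiff_sphereConjFun H.contDiff H.injective h0 hfar)
  contMDiff_invFun := contMDiff_iff_contDiff.2
    (contDiff_sphereConjFun H.symm.contDiff H.symm.injective (symm_apply_zero_of H h0)
      (fun _ hx => symm_apply_eq_self_of H hfar hx))

variable (h0 : H 0 = 0) (hfar : ∀ x, 1 ≤ ‖x‖ → H x = x)

/-- `sphereConjDiffeomorph H _ _ z = ι (H (ι z))`. [folklore] -/
@[simp] theorem sphereConjDiffeomorph_apply (z : F) :
    sphereConjDiffeomorph H h0 hfar z = ι (H (ι z)) := rfl

/-- `sphereConjDiffeomorph H _ _ (ι y) = ι (H y)`: the conjugate is `H` transported by `ι`.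
[folklore] -/
theorem sphereConjDiffeomorph_sphereInversion (y : F) :
    sphereConjDiffeomorph H h0 hfar (ι y) = ι (H y) := by simp

/-- `sphereConjDiffeomorph H _ _` is the identity on the closed unit ball. [folklore] -/
theorem sphereConjDiffeomorph_of_norm_le_one {z : F} (hz : ‖z‖ ≤ 1) :
    sphereConjDiffeomorph H h0 hfar z = z :=
  sphereConjFun_of_norm_le_one h0 hfar hz

end SphereConj


end InnerProductSpace

section Straighten

variable {F : Type*} [NormedAddCommGroup F] [InnerProductSpace ℝ F]

/-! ### Straightening `ι ∘ A ∘ ι` at the origin -/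

namespace InvertedLinear

variable (A : F ≃L[ℝ] F)

/-- The lower bound `c = (‖A‖² + 1)⁻¹` of the ratio `‖z‖² / ‖A z‖²`. [folklore] -/
def lower : ℝ := (‖(A : F →L[ℝ] F)‖ ^ 2 + 1)⁻¹

/-- The degree-`0` homogeneous ratio `ρ z = ‖z‖² / ‖A z‖²` (so that `ι (A (ι z)) = ρ z • A z`).
[folklore] -/
def ratio (z : F) : ℝ := ‖z‖ ^ 2 / ‖A z‖ ^ 2

/-- The radial cutoff `χ z = smoothTransition (2 - ‖z‖²)`: `1` on the closed unit ball, `0` when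
`‖z‖² ≥ 2`, non-increasing along rays. [folklore] -/
def cutoff (z : F) : ℝ := Real.smoothTransition (2 - ‖z‖ ^ 2)

/-- The interpolated factor `μ = ρ + χ · (c - ρ)`: equal to `c` on the unit ball and to `ρ` when
`‖z‖² ≥ 2`. [folklore] -/
def factor (z : F) : ℝ := ratio A z + cutoff z * (lower A - ratio A z)

/-- The straightened map `G z = μ z • A z`: linear (`= c • A`) on the unit ball and equal to
`ι ∘ A ∘ ι` when `‖z‖² ≥ 2`. [folklore] -/
def straighten (z : F) : F := factor A z • A z

/-- `0 < c`. [folklore] -/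
theorem lower_pos : 0 < lower A := by
  unfold lower; positivity

/-- `A z ≠ 0` for `z ≠ 0` (`A` is invertible). [folklore] -/
theorem norm_A_pos {z : F} (hz : z ≠ 0) : 0 < ‖A z‖ :=
  norm_pos_iff.2 (by simpa using hz)

/-- The lower bound `c ≤ ρ z` for `z ≠ 0`, from `‖A z‖ ≤ ‖A‖ ‖z‖`. [folklore] -/
theorem lower_le_ratio {z : F} (hz : z ≠ 0) : lower A ≤ ratio A z := by
  have hAz : 0 < ‖A z‖ ^ 2 := pow_pos (norm_A_pos A hz) 2
  rw [ratio, lower, le_div_iff₀ hAz]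
  have h1 : ‖A z‖ ≤ ‖(A : F →L[ℝ] F)‖ * ‖z‖ := (A : F →L[ℝ] F).le_opNorm z
  have h2 : ‖A z‖ ^ 2 ≤ (‖(A : F →L[ℝ] F)‖ ^ 2 + 1) * ‖z‖ ^ 2 := by
    calc ‖A z‖ ^ 2 ≤ (‖(A : F →L[ℝ] F)‖ * ‖z‖) ^ 2 := by gcongr
      _ = ‖(A : F →L[ℝ] F)‖ ^ 2 * ‖z‖ ^ 2 := by ring
      _ ≤ (‖(A : F →L[ℝ] F)‖ ^ 2 + 1) * ‖z‖ ^ 2 := by gcongr; linarith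
  have h3 : 0 < ‖(A : F →L[ℝ] F)‖ ^ 2 + 1 := by positivity
  calc (‖(A : F →L[ℝ] F)‖ ^ 2 + 1)⁻¹ * ‖A z‖ ^ 2
      ≤ (‖(A : F →L[ℝ] F)‖ ^ 2 + 1)⁻¹ * ((‖(A : F →L[ℝ] F)‖ ^ 2 + 1) * ‖z‖ ^ 2) := by gcongr
    _ = ‖z‖ ^ 2 := by field_simp

/-- `0 < ρ z` for `z ≠ 0`. [folklore] -/
theorem ratio_pos {z : F} (hz : z ≠ 0) : 0 < ratio A z :=
  (lower_pos A).trans_le (lower_le_ratio A hz)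

/-- `ρ` is homogeneous of degree `0`: `ρ (t • z) = ρ z` for `t ≠ 0`. [folklore] -/
theorem ratio_smul {t : ℝ} (ht : t ≠ 0) (z : F) : ratio A (t • z) = ratio A z := by
  simp only [ratio, map_smul, norm_smul, mul_pow, Real.norm_eq_abs, sq_abs]
  rcases eq_or_ne z 0 with rfl | hz
  · simp
  rw [mul_div_mul_left _ _ (pow_ne_zero 2 ht)]

omit [InnerProductSpace ℝ F] in
/-- `0 ≤ χ`. [folklore] -/
theorem cutoff_nonneg (z : F) : 0 ≤ cutoff z := Real.smoothTransition.nonneg _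

omit [InnerProductSpace ℝ F] in
/-- `χ ≤ 1`. [folklore] -/
theorem cutoff_le_one (z : F) : cutoff z ≤ 1 := Real.smoothTransition.le_one _

omit [InnerProductSpace ℝ F] in
/-- `χ = 1` on the closed unit ball. [folklore] -/
theorem cutoff_of_norm_le_one {z : F} (hz : ‖z‖ ≤ 1) : cutoff z = 1 := by
  apply Real.smoothTransition.one_of_one_le
  have : ‖z‖ ^ 2 ≤ 1 := by nlinarith [norm_nonneg z]
  linarith

omit [InnerProductSpace ℝ F] in
/-- `χ z = 0` when `2 ≤ ‖z‖²`. [folklore] -/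
theorem cutoff_of_two_le {z : F} (hz : 2 ≤ ‖z‖ ^ 2) : cutoff z = 0 :=
  Real.smoothTransition.zero_of_nonpos (by linarith)

/-- `χ` is non-increasing along rays: `χ (t • z) ≤ χ (s • z)` for `0 ≤ s ≤ t`. [folklore] -/
theorem cutoff_smul_le_cutoff_smul {s t : ℝ} (hs : 0 ≤ s) (hst : s ≤ t) (z : F) :
    cutoff (t • z) ≤ cutoff (s • z) := by
  apply Real.smoothTransition.monotone
  simp only [norm_smul, mul_pow, Real.norm_eq_abs, sq_abs]
  have : s ^ 2 ≤ t ^ 2 := by gcongr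
  nlinarith [sq_nonneg ‖z‖]

/-- `χ` is smooth. [folklore] -/
theorem contDiff_cutoff : ContDiff ℝ ∞ (cutoff : F → ℝ) :=
  Real.smoothTransition.contDiff.comp (contDiff_const.sub (contDiff_norm_sq ℝ))

/-- `μ = c` on the closed unit ball. [folklore] -/
theorem factor_of_norm_le_one {z : F} (hz : ‖z‖ ≤ 1) : factor A z = lower A := by
  rw [factor, cutoff_of_norm_le_one hz]; ring

/-- `μ 0 = c`. [folklore] -/
@[simp] theorem factor_zero : factor A 0 = lower A := factor_of_norm_le_one A (by simp)

/-- `μ z = ρ z` when `2 ≤ ‖z‖²`. [folklore] -/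
theorem factor_of_two_le {z : F} (hz : 2 ≤ ‖z‖ ^ 2) : factor A z = ratio A z := by
  rw [factor, cutoff_of_two_le hz]; ring

/-- `c ≤ μ` everywhere (`μ` interpolates between `c` and `ρ ≥ c`). [folklore] -/
theorem lower_le_factor (z : F) : lower A ≤ factor A z := by
  rcases eq_or_ne z 0 with rfl | hz
  · simp
  have h1 := lower_le_ratio A hz
  have h2 := cutoff_nonneg z
  have h3 := cutoff_le_one z
  have : factor A z - lower A = (1 - cutoff z) * (ratio A z - lower A) := by rw [factor]; ring
  nlinarith

/-- `0 < μ` everywhere. [folklore] -/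
theorem factor_pos (z : F) : 0 < factor A z := (lower_pos A).trans_le (lower_le_factor A z)

/-- `μ (t • z) = ρ z + χ (t • z) (c - ρ z)` for `t ≠ 0` (only the cutoff depends on `t`). [folklore]
-/
theorem factor_smul_eq {t : ℝ} (ht : t ≠ 0) (z : F) :
    factor A (t • z) = ratio A z + cutoff (t • z) * (lower A - ratio A z) := by
  rw [factor, ratio_smul A ht]

/-- Along each ray, `t ↦ μ (t • z)` is non-decreasing on `[0, ∞)`. [folklore] -/
theorem monotoneOn_factor_smul (z : F) : MonotoneOn (fun t : ℝ => factor A (t • z)) (Ici 0) := by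
  intro s hs t _ hst
  simp only [mem_Ici] at hs
  rcases hs.eq_or_lt with rfl | hs0
  · simpa using lower_le_factor A (t • z)
  rcases eq_or_ne z 0 with rfl | hz
  · simp
  have ht0 : 0 < t := hs0.trans_le hst
  dsimp only
  rw [factor_smul_eq A hs0.ne' z, factor_smul_eq A ht0.ne' z]
  have h1 : cutoff (t • z) ≤ cutoff (s • z) := cutoff_smul_le_cutoff_smul hs0.le hst z
  have h2 : lower A - ratio A z ≤ 0 := sub_nonpos.2 (lower_le_ratio A hz)
  nlinarith

/-- The radial function `φ_z(t) = t · μ (t • z)`, so that `G (t • z) = φ_z(t) • A z`. [folklore] -/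
def radial (z : F) (t : ℝ) : ℝ := t * factor A (t • z)

/-- `G (t • z) = φ_z(t) • A z` along the ray through `z`. [folklore] -/
theorem straighten_smul (z : F) (t : ℝ) : straighten A (t • z) = radial A z t • A z := by
  simp [straighten, radial, smul_smul, mul_comm]

/-- `φ_z(0) = 0`. [folklore] -/
theorem radial_zero (z : F) : radial A z 0 = 0 := by simp [radial]

/-- `φ_z(1) = μ z`. [folklore] -/
theorem radial_one (z : F) : radial A z 1 = factor A z := by simp [radial]

/-- `c t ≤ φ_z(t)` for `t ≥ 0` (so `φ_z` is unbounded). [folklore] -/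
theorem lower_mul_le_radial (z : F) {t : ℝ} (ht : 0 ≤ t) : lower A * t ≤ radial A z t := by
  rw [radial, mul_comm]
  exact mul_le_mul_of_nonneg_left (lower_le_factor A _) ht

/-- `φ_z` is strictly increasing on `[0, ∞)` (product of `t` and the positive non-decreasing `t ↦ μ
(t • z)`). [folklore] -/
theorem strictMonoOn_radial (z : F) : StrictMonoOn (radial A z) (Ici 0) := by
  intro s hs t ht hst
  simp only [mem_Ici] at hs ht
  have hmono := monotoneOn_factor_smul A z hs (hs.trans hst.le) hst.le
  simp only at hmono
  have hpos := factor_pos A (t • z)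
  rw [radial, radial]
  nlinarith

/-- `φ_z` is continuous if `μ` is smooth (auxiliary form; see `continuous_radial`). [folklore] -/
theorem continuous_factor_of_contDiff (h : ContDiff ℝ ∞ (factor A)) (z : F) :
    Continuous (radial A z) :=
  continuous_id.mul (h.continuous.comp (continuous_id.smul continuous_const))

/-! #### Smoothness -/

/-- `ρ` is smooth away from `0`. [folklore] -/
theorem contDiffAt_ratio {z : F} (hz : z ≠ 0) : ContDiffAt ℝ ∞ (ratio A) z := by
  have h1 : ContDiffAt ℝ ∞ (fun y : F => ‖y‖ ^ 2) z := (contDiff_norm_sq ℝ).contDiffAt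
  have h2 : ContDiffAt ℝ ∞ (fun y : F => ‖A y‖ ^ 2) z :=
    ((A : F →L[ℝ] F).contDiff.norm_sq ℝ).contDiffAt
  exact h1.div h2 (pow_ne_zero 2 (norm_A_pos A hz).ne')

/-- `μ` is smooth at every point (constant near the unit ball, a smooth combination elsewhere).
[folklore] -/
theorem contDiffAt_factor (z : F) : ContDiffAt ℝ ∞ (factor A) z := by
  by_cases hz : ‖z‖ < 1
  · have : factor A =ᶠ[𝓝 z] fun _ => lower A := by
      filter_upwards [isOpen_ball.mem_nhds (mem_ball_zero_iff.2 hz)] with y hy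
      exact factor_of_norm_le_one A (le_of_lt (mem_ball_zero_iff.1 hy))
    exact contDiffAt_const.congr_of_eventuallyEq this
  · have hz0 : z ≠ 0 := by rintro rfl; exact hz (by simp)
    have hρ := contDiffAt_ratio A hz0
    exact hρ.add (contDiff_cutoff.contDiffAt.mul (contDiffAt_const.sub hρ))

/-- `μ` is smooth. [folklore] -/
theorem contDiff_factor : ContDiff ℝ ∞ (factor A) :=
  contDiff_iff_contDiffAt.2 (contDiffAt_factor A)

/-- The straightened map `G = μ • A` is smooth. [folklore] -/
theorem contDiff_straighten : ContDiff ℝ ∞ (straighten A) :=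
  (contDiff_factor A).smul (A : F →L[ℝ] F).contDiff

/-- `φ_z` is continuous. [folklore] -/
theorem continuous_radial (z : F) : Continuous (radial A z) :=
  continuous_factor_of_contDiff A (contDiff_factor A) z

/-! #### Bijectivity -/

/-- `G 0 = 0`. [folklore] -/
theorem straighten_zero : straighten A 0 = 0 := by simp [straighten]

/-- `G z = 0 ↔ z = 0`. [folklore] -/
theorem straighten_eq_zero_iff {z : F} : straighten A z = 0 ↔ z = 0 := by
  refine ⟨fun h => ?_, fun h => by rw [h, straighten_zero]⟩
  rw [straighten, smul_eq_zero] at h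
  rcases h with h | h
  · exact absurd h (factor_pos A z).ne'
  · simpa using h

/-- `G` is injective: `G z₁ = G z₂` forces `z₂ = s • z₁` with `s > 0` and then `φ(s) = φ(1)`, so `s
= 1` by strict monotonicity. [folklore] -/
theorem injective_straighten : Injective (straighten A) := by
  intro z₁ z₂ h
  rcases eq_or_ne z₁ 0 with rfl | hz₁
  · rw [straighten_zero, eq_comm, straighten_eq_zero_iff] at h; exact h.symm
  rcases eq_or_ne z₂ 0 with rfl | hz₂
  · rw [straighten_zero, straighten_eq_zero_iff] at h; exact h
  -- `z₂` is a positive multiple of `z₁`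
  have hμ₁ := factor_pos A z₁
  have hμ₂ := factor_pos A z₂
  set s : ℝ := factor A z₁ / factor A z₂ with hs
  have hs0 : 0 < s := div_pos hμ₁ hμ₂
  have hz₂eq : z₂ = s • z₁ := by
    have h' : factor A z₁ • z₁ = factor A z₂ • z₂ := by
      apply A.injective
      simpa [straighten, map_smul] using h
    rw [hs, div_eq_mul_inv, mul_comm, ← smul_smul, h', smul_smul, inv_mul_cancel₀ hμ₂.ne', one_smul]
  -- compare the radial functions at `1` and at `s`
  have hrad : radial A z₁ s = radial A z₁ 1 := by
    have h1 : straighten A z₂ = radial A z₁ s • A z₁ := by rw [hz₂eq, straighten_smul]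
    have h2 : straighten A z₁ = radial A z₁ 1 • A z₁ := by
      conv_lhs => rw [← one_smul ℝ z₁]
      rw [straighten_smul]
    have hAz : A z₁ ≠ 0 := by simpa using hz₁
    exact smul_left_injective ℝ hAz (h1.symm.trans (h.symm.trans h2))
  have hs1 : s = 1 :=
    (strictMonoOn_radial A z₁).injOn (mem_Ici.2 hs0.le) (mem_Ici.2 zero_le_one) hrad
  rw [hz₂eq, hs1, one_smul]

/-- `G` is surjective: on the ray through `A⁻¹ w` the continuous unbounded `φ` takes the value `1`
(intermediate value theorem). [folklore] -/
theorem surjective_straighten : Surjective (straighten A) := by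
  intro w
  rcases eq_or_ne w 0 with rfl | hw
  · exact ⟨0, straighten_zero A⟩
  set u : F := A.symm w with hu
  have hu0 : u ≠ 0 := by simpa [hu] using hw
  -- intermediate value theorem for `radial A u` on `[0, T]`, `T = (lower A)⁻¹`
  set T : ℝ := (lower A)⁻¹ with hT
  have hT0 : 0 ≤ T := inv_nonneg.2 (lower_pos A).le
  have h1 : (1 : ℝ) ∈ Icc (radial A u 0) (radial A u T) := by
    refine ⟨by simp [radial_zero], ?_⟩
    calc (1 : ℝ) = lower A * T := by rw [hT, mul_inv_cancel₀ (lower_pos A).ne']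
      _ ≤ radial A u T := lower_mul_le_radial A u hT0
  obtain ⟨t, _, ht⟩ := intermediate_value_Icc hT0 (continuous_radial A u).continuousOn h1
  refine ⟨t • u, ?_⟩
  rw [straighten_smul, ht, one_smul, hu, A.apply_symm_apply]

/-! #### The differential is injective -/

/-- The radial derivative `Dμ(z) z` is non-negative (monotonicity of `t ↦ μ (t • z)`). [folklore] -/
theorem fderiv_factor_self_nonneg (z : F) : 0 ≤ fderiv ℝ (factor A) z z := by
  -- `t ↦ μ (t • z)` is monotone on `[0, ∞)` and has derivative `Dμ(z) z` at `t = 1`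
  set m : ℝ → ℝ := fun t => factor A (t • z) with hm
  have hderiv : HasDerivAt m (fderiv ℝ (factor A) z z) 1 := by
    have h1 : HasFDerivAt (factor A) (fderiv ℝ (factor A) z) ((1 : ℝ) • z) := by
      rw [one_smul]
      exact ((contDiffAt_factor A z).differentiableAt (by simp)).hasFDerivAt
    have h2 : HasDerivAt (fun t : ℝ => t • z) ((1 : ℝ) • z) 1 :=
      (hasDerivAt_id (1 : ℝ)).smul_const z
    have h3 := h1.comp_hasDerivAt (1 : ℝ) h2
    rw [one_smul] at h3
    exact h3
  have hmono : MonotoneOn m (Ici 0) := monotoneOn_factor_smul A z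
  have h0 : 0 ≤ derivWithin m (Ici 0) 1 := hmono.derivWithin_nonneg
  rwa [derivWithin_of_mem_nhds (Ici_mem_nhds one_pos), hderiv.deriv] at h0

/-- Product rule: `DG(z) v = μ z • A v + (Dμ(z) v) • A z`. [folklore] -/
theorem fderiv_straighten_apply (z v : F) :
    fderiv ℝ (straighten A) z v = factor A z • A v + (fderiv ℝ (factor A) z v) • A z := by
  have hc : DifferentiableAt ℝ (factor A) z := (contDiffAt_factor A z).differentiableAt (by simp)
  have hf : DifferentiableAt ℝ (A : F → F) z := A.differentiableAt
  have : fderiv ℝ (straighten A) z =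
      factor A z • fderiv ℝ (A : F → F) z + (fderiv ℝ (factor A) z).smulRight (A z) :=
    fderiv_fun_smul hc hf
  rw [this]
  simp [ContinuousLinearMap.smulRight_apply, A.fderiv]

/-- The differential `DG(z)` is injective at every point: a kernel vector is a multiple `κ z` of `z`
with `κ (μ z + Dμ(z) z) = 0`, and `μ z + Dμ(z) z > 0`. [folklore] -/
theorem injective_fderiv_straighten (z : F) : Injective (fderiv ℝ (straighten A) z) := by
  rw [injective_iff_map_eq_zero]
  intro v hv
  rw [fderiv_straighten_apply] at hv
  -- `A (μ • v + (Dμ v) • z) = 0`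
  have h1 : factor A z • v + (fderiv ℝ (factor A) z v) • z = 0 := by
    apply A.injective
    simpa [map_add, map_smul] using hv
  rcases eq_or_ne z 0 with rfl | hz
  · simp only [smul_zero, add_zero, smul_eq_zero] at h1
    exact h1.resolve_left (factor_pos A 0).ne'
  set μ := factor A z with hμ
  set ℓ := fderiv ℝ (factor A) z with hℓ
  have hμ0 : 0 < μ := factor_pos A z
  -- `v` is a multiple of `z`
  set κ : ℝ := -(ℓ v) / μ with hκ
  have hv' : v = κ • z := by
    have : μ • v = -(ℓ v) • z := eq_neg_of_add_eq_zero_left h1 |>.trans (neg_smul _ _).symm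
    calc v = μ⁻¹ • (μ • v) := by rw [smul_smul, inv_mul_cancel₀ hμ0.ne', one_smul]
      _ = κ • z := by rw [this, smul_smul, hκ, div_eq_inv_mul]
  have hd : 0 ≤ ℓ z := fderiv_factor_self_nonneg A z
  have h2 : κ * (μ + ℓ z) = 0 := by
    have h3 : (κ * (μ + ℓ z)) • z = 0 := by
      have := h1
      rw [hv', map_smul, smul_eq_mul, smul_smul] at this
      rw [← this, ← add_smul]
      congr 1; ring
    exact (smul_eq_zero.1 h3).resolve_right hz
  have hκ0 : κ = 0 := by
    rcases mul_eq_zero.1 h2 with h | h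
    · exact h
    · linarith
  rw [hv', hκ0, zero_smul]

/-! #### The straightened map equals `ι A ι` near infinity -/

/-- `G = ι ∘ A ∘ ι` where `‖z‖² ≥ 2` (there `μ = ρ` and `ι (A (ι z)) = ρ z • A z`). [folklore] -/
theorem straighten_eq_of_two_le {z : F} (hz : 2 ≤ ‖z‖ ^ 2) :
    straighten A z = sphereInversion (A (sphereInversion z)) := by
  have hz0 : z ≠ 0 := by
    rintro rfl; norm_num at hz
  have hn : ‖z‖ ≠ 0 := norm_ne_zero_iff.2 hz0
  have hAn : ‖A z‖ ≠ 0 := (norm_A_pos A hz0).ne'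
  rw [straighten, factor_of_two_le A hz, ratio, sphereInversion, sphereInversion, map_smul,
    norm_smul, smul_smul, norm_inv, norm_pow, norm_norm]
  congr 1
  field_simp

end InvertedLinear


end Straighten

/-! ### The main theorem: extending `ι ∘ h ∘ ι` -/

section Main

variable {F : Type*} [NormedAddCommGroup F] [InnerProductSpace ℝ F] [FiniteDimensional ℝ F]

local notation "ι" => sphereInversion

/-- The straightening diffeomorphism `G₂` of step 4: a diffeomorphism of `F` equal to `ι ∘ A ∘ ι`
when `‖z‖² ≥ 2`. [folklore] -/
def InvertedLinear.straightenDiffeomorph (A : F ≃L[ℝ] F) : F ≃ₘ⟮𝓘(ℝ, F), 𝓘(ℝ, F)⟯ F :=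
  diffeomorphOfContDiffBijective (InvertedLinear.straighten A)
    (InvertedLinear.contDiff_straighten A)
    ⟨InvertedLinear.injective_straighten A, InvertedLinear.surjective_straighten A⟩
    (InvertedLinear.injective_fderiv_straighten A)

/-- `straightenDiffeomorph A` is `straighten A` as a function. [folklore] -/
@[simp] theorem InvertedLinear.straightenDiffeomorph_apply (A : F ≃L[ℝ] F) (z : F) :
    InvertedLinear.straightenDiffeomorph A z = InvertedLinear.straighten A z := rfl

/-- **Straightening the inverted linear map** (step 4): for every `A ∈ GL(F)` there is a
diffeomorphism of `F` that agrees with `ι ∘ A ∘ ι` outside the ball of radius `√2`. [folklore] -/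
theorem exists_diffeomorph_eq_sphereInversion_conj_linear (A : F ≃L[ℝ] F) :
    ∃ G : F ≃ₘ⟮𝓘(ℝ, F), 𝓘(ℝ, F)⟯ F, ∀ z, 2 ≤ ‖z‖ ^ 2 → G z = ι (A (ι z)) :=
  ⟨InvertedLinear.straightenDiffeomorph A, fun _ hz => InvertedLinear.straighten_eq_of_two_le A hz⟩

/-- **Extension of an inverted germ (Palais 1960, Thm. B / §5, Euclidean form).** Let `h` be
`C^∞` on a neighbourhood of `0` in a finite-dimensional real inner product space, `h 0 = 0`, with
invertible differential `A = Dh(0)`. Then there are a diffeomorphism `G` of `F` and `δ > 0` such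
that `G (ι y) = ι (h y)` whenever `0 < ‖y‖ < δ`: the germ at infinity `ι ∘ h ∘ ι` extends to a
global diffeomorphism. [cite: Palais1960, Thm. B] -/
theorem exists_diffeomorph_sphereInversion_conj {h : F → F} {s : Set F} (hs : s ∈ 𝓝 (0 : F))
    (hh : ContDiffOn ℝ ∞ h s) (h0 : h 0 = 0) (A : F ≃L[ℝ] F)
    (hA : (A : F →L[ℝ] F) = fderiv ℝ h 0) :
    ∃ (G : F ≃ₘ⟮𝓘(ℝ, F), 𝓘(ℝ, F)⟯ F) (δ : ℝ), 0 < δ ∧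
      ∀ y, y ≠ 0 → ‖y‖ < δ → G (ι y) = ι (h y) := by
  -- Step 0: normalise the linear part, `h₁ = A⁻¹ ∘ h` has `Dh₁(0) = id`.
  set h₁ : F → F := fun y => A.symm (h y) with hh₁_def
  have hh₁ : ContDiffOn ℝ ∞ h₁ s := A.symm.contDiff.comp_contDiffOn hh
  have h₁0 : h₁ 0 = 0 := by simp [hh₁_def, h0]
  have hdiff : DifferentiableAt ℝ h 0 := (hh.contDiffAt hs).differentiableAt (by simp)
  have hd₁ : fderiv ℝ h₁ 0 = ContinuousLinearMap.id ℝ F := by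
    have : HasFDerivAt h₁ ((A.symm : F →L[ℝ] F).comp (fderiv ℝ h 0)) 0 :=
      A.symm.hasFDerivAt.comp 0 hdiff.hasFDerivAt
    rw [this.fderiv, ← hA]
    ext v
    simp
  -- Steps 2–3: extend `h₁` and conjugate by `ι`.
  obtain ⟨H, δ₁, hδ₁, hHnear, hHfar⟩ :=
    GermExtension.exists_diffeomorph_eq_near_zero_eq_id_far hs hh₁ h₁0 hd₁
  have hH0 : H 0 = 0 := by rw [hHnear 0 (by simpa using hδ₁.le), h₁0]
  set G₁ := sphereConjDiffeomorph H hH0 hHfar with hG₁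
  -- Step 4: straighten `ι A ι`.
  set G₂ := InvertedLinear.straightenDiffeomorph A with hG₂
  -- `h₁` is small near `0`
  have hcont : ContinuousAt h₁ 0 := (hh₁.contDiffAt hs).continuousAt
  obtain ⟨δ₂, hδ₂, hδ₂b⟩ := Metric.continuousAt_iff.1 hcont (1 / 2) one_half_pos
  refine ⟨G₁.trans G₂, min δ₁ δ₂, lt_min hδ₁ hδ₂, fun y hy0 hy => ?_⟩
  have hy₁ : ‖y‖ ≤ δ₁ := (le_of_lt hy).trans (min_le_left _ _)
  have hy₂ : ‖y‖ < δ₂ := lt_of_lt_of_le hy (min_le_right _ _)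
  have hHy : H y = h₁ y := hHnear y hy₁
  have hHy0 : H y ≠ 0 := fun h' => hy0 (H.injective (h'.trans hH0.symm))
  have hsmall : ‖h₁ y‖ < 1 / 2 := by
    have := hδ₂b (show dist y 0 < δ₂ by simpa using hy₂)
    rwa [h₁0, dist_zero_right] at this
  have hbig : 2 ≤ ‖ι (h₁ y)‖ ^ 2 := by
    rw [sphereInversion.norm_apply]
    have hpos : 0 < ‖h₁ y‖ := norm_pos_iff.2 (hHy ▸ hHy0)
    have h2 : 2 ≤ ‖h₁ y‖⁻¹ := by
      rw [le_inv_comm₀ two_pos hpos]; linarith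
    nlinarith
  calc (G₁.trans G₂) (ι y) = G₂ (G₁ (ι y)) := rfl
    _ = G₂ (ι (h₁ y)) := by rw [hG₁, sphereConjDiffeomorph_sphereInversion, hHy]
    _ = ι (A (ι (ι (h₁ y)))) := by
        rw [hG₂, InvertedLinear.straightenDiffeomorph_apply,
          InvertedLinear.straighten_eq_of_two_le A hbig]
    _ = ι (h y) := by rw [sphereInversion.apply_apply, hh₁_def]; simp

end Main

end Literature.Topology.FourManifolds

end
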